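import Summits.RiemannHypothesis.RiemannHypothesis.Theorems.Splittings.RobinFiniteC1Core
import Summits.RiemannHypothesis.RiemannHypothesis.Theorems.Splittings.RobinFiniteC1Windows
import Summits.RiemannHypothesis.RiemannHypothesis.Theorems.Splittings.RobinFiniteE3Large2
import Summits.RiemannHypothesis.RiemannHypothesis.Theorems.Splittings.RobinFiniteE3Main
import HarnessLib

/-!
# RobinFiniteC1Main — Part 5/5 — dispatch and headline: `negLog_le_Eb1_PT`, `mertensProdLt_PT2` (`4¹¹ ≤ P ≤ 2.5·10²²`),
`robinCA_below_PT2 : Buthe2016_thm2 → Buthe2018_thm2_theta → BroadbentEtAl2021_theta_rel_1e19 →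
RiemannHypothesisUpTo 3000175332800 → robinCA_below (25·10²¹ + 1)`, and the monotone corollary `robinCA_below_PT1`
(`10²¹ + 1`).

Robin's inequality at every colossally abundant `N > 5040` all of whose primes are `≤ 2.5·10²²` (informal n-currency
`5040 < n < 10^(10^22.03)`; gen 7 `RobinFiniteE3Main.robinCA_below_PT`: `2.5·10²⁰`, `10^(10^20.0)`), modulo the SAME four
print-only facts {Büthe 2016 Thm 2, Büthe 2018 Thm 2, Broadbent–Kadiri–Lumley–Ng–Wilk 2021, RH up to `3 000 175 332 800`
(Platt–Trudgian 2021)}.  Dispatch: cells `P < 2·10¹⁰` (`key_ineq_cellsW`, budget `≤ 0.04631`); `G_largeW` (`2.1538`) with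
windows V1, V2, V3b on `[2·10¹⁰, 2·10¹⁹]`; `G_large2W` with windows Z1–Z5 on `[2·10¹⁹, 2.5·10²²]`.

Cell rh-split, seat rh-split-robin-finite g8 (brief sha16 f79c5f09d8bcb036), card `cards/SPLIT-robin-finite.md` §15;
carved from the kernel-checked object `HOME/rh-split-robin-finite/g8/SketchG8-G.lean` (sha16 b720eb98042decc0, rc 0,
0 warnings, 0 sorries, axioms [propext, Classical.choice, Quot.sound]).  Zero `def`, zero `instance`, zero `notation`,
no attribute changes, no `native_decide`.

HONEST LABEL: SPLITTING SEARCH over kernel-typed RH-EQUIVALENCES; a splitting A ∧ B ⟹ RH is CONDITIONAL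
bookkeeping unless A and B are both proved; nothing here bears on the truth of RH.
-/

set_option linter.dupNamespace false

noncomputable section

open Real Filter Finset
open scoped Chebyshev

namespace Summit.RiemannHypothesis.RiemannHypothesis.Theorems.Splittings.RobinFiniteC1

open Literature.NumberTheory.LFunctions Literature.NumberTheory.DiophantineGeometry
open RobinAnalyticSharp
open Summit.RiemannHypothesis.RiemannHypothesis.Theorems.Splittings.RobinFiniteE3

/-- c = 1 · **the tail-free windowed lower bound, restated in the E3 shape**: modulo Büthe 2016 (Thm 2), Büthe 2018 (Thm 2),
BKLNW 2021 and RH up to `3 000 175 332 800`, `−log f(x) ≤ Eb (budgetPT1 X₀ X₁) x` for `599 ≤ x ∈ [X₀, X₁]`, `1 < X₀`,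
`X₁ ≤ 2.169·10²⁵`, `budgetPT1 X₀ X₁ = 0.0463 + (1 + 2/log X₀)·2.961·10⁻¹²·√X₁` (Part A `nicolasLowerBetween1_PT_tailFree`). -/
theorem negLog_le_Eb1_PT (h16 : Buthe2016_thm2) (hB : Buthe2018_thm2_theta)
    (hK : BroadbentEtAl2021_theta_rel_1e19) (hRH : RiemannHypothesisUpTo 3000175332800)
    {X₀ X₁ : ℝ} (hX₀ : 1 < X₀) (hX₁ : X₁ ≤ 2.169e25) {x : ℝ} (hx : 599 ≤ x) (h0 : X₀ ≤ x) (h1 : x ≤ X₁) :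
    -Real.log (nicolasF x) ≤ (nicolasERH x + ((0.0463 + (1 + 2 / Real.log X₀) * (2.961e-12 * √X₁)) - nicolasBeta) * (1 / (√x * Real.log x) + 1 / (√x * Real.log x ^ 2) + 4 / (√x * Real.log x ^ 3))) :=
  nicolasLowerBetween1_PT_tailFree h16 hB hK hRH hX₀ hX₁ x hx h0 h1

/-- **The CA Mertens inequality for `4¹¹ ≤ P ≤ 2.5·10²²`, `Q ≤ P`**, modulo the same four print-only facts as
`RobinFiniteE3Main.mertensProdLt_PT`: cells below `2·10¹⁰`; `G_largeW` (`2.1538`) with the c = 1 windows V1, V2, V3b on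
`[2·10¹⁰, 2·10¹⁹]`; `G_large2W` (lifted constant per window) with the windows Z1–Z5 on `(2·10¹⁹, 2.5·10²²]`. -/
theorem mertensProdLt_PT2 (h16 : Buthe2016_thm2) (hB : Buthe2018_thm2_theta)
    (hK : BroadbentEtAl2021_theta_rel_1e19) (hRH : RiemannHypothesisUpTo 3000175332800) {P Q : ℕ}
    (hP : 4 ^ 11 ≤ P) (hPX : (P : ℝ) ≤ 25 * (10 : ℝ) ^ 21) (hQP : Q ≤ P) :
    (∏ p ∈ Nat.primesLE P, (1 - (p : ℝ)⁻¹))⁻¹ *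
        ∏ p ∈ (Nat.primesLE P).filter (fun p => Q < p), (1 - ((p : ℝ) ^ 2)⁻¹) <
      rexp eulerMascheroniConstant * Real.log (θ P + θ Q) := by
  have hW : (∀ y : ℝ, 599 ≤ y → y ≤ 2.169e25 → |θ y - y| ≤ √y * Real.log y ^ 2 / (8 * π)) :=
    thetaWindow_PT h16 hRH
  have hPB : (P : ℝ) ≤ 2.169e25 := hPX.trans (by norm_num)
  have hPr : (4 : ℝ) ^ 11 ≤ P := by exact_mod_cast hP
  have hP599 : (599 : ℝ) ≤ P := le_trans (by norm_num) hPr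
  have hP1 : (1 : ℝ) < P := by linarith
  have hlow : ∀ X₀ X₁ : ℝ, 1 < X₀ → X₁ ≤ 2.169e25 → X₀ ≤ (P : ℝ) → (P : ℝ) ≤ X₁ →
      -Real.log (nicolasF P) ≤ (nicolasERH P + ((0.0463 + (1 + 2 / Real.log X₀) * (2.961e-12 * √X₁)) - nicolasBeta) * (1 / (√P * Real.log P) + 1 / (√P * Real.log P ^ 2) + 4 / (√P * Real.log P ^ 3))) :=
    fun X₀ X₁ hX₀ hX₁ h0 h1 => negLog_le_Eb1_PT h16 hB hK hRH hX₀ hX₁ hP599 h0 h1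
  by_cases hbig : (2 * 10 ^ 10 : ℝ) ≤ P
  · have hsL : 0 < √(P : ℝ) * Real.log P :=
      mul_pos (Real.sqrt_pos.2 (by linarith)) (Real.log_pos hP1)
    rcases le_or_gt (P : ℝ) (2 * (10 : ℝ) ^ 19) with h19 | h19
    · -- the old large branch `2·10¹⁰ ≤ P ≤ 2·10¹⁹`: constant `2.1538`
      have hG := G_largeW hW hbig hPB hQP
      suffices hwin : ∃ X₀ X₁ : ℝ, 1 < X₀ ∧ X₁ ≤ 2.169e25 ∧ X₀ ≤ (P : ℝ) ∧ (P : ℝ) ≤ X₁ ∧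
          (nicolasERH P + ((0.0463 + (1 + 2 / Real.log X₀) * (2.961e-12 * √X₁)) - nicolasBeta) * (1 / (√P * Real.log P) + 1 / (√P * Real.log P ^ 2) + 4 / (√P * Real.log P ^ 3))) * (√(P : ℝ) * Real.log P) < 2.1538 by
        obtain ⟨X₀, X₁, hX₀, hX₁, h0, h1, hlt⟩ := hwin
        refine mertens_prod_lt_of hW hP hPB (hlow X₀ X₁ hX₀ hX₁ h0 h1) ?_
        have : (nicolasERH P + ((0.0463 + (1 + 2 / Real.log X₀) * (2.961e-12 * √X₁)) - nicolasBeta) * (1 / (√P * Real.log P) + 1 / (√P * Real.log P ^ 2) + 4 / (√P * Real.log P ^ 3))) < 2.1538 / (√(P : ℝ) * Real.log P) := by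
          rw [lt_div_iff₀ hsL]; exact hlt
        exact this.trans_le hG
      rcases le_or_gt (P : ℝ) ((10 : ℝ) ^ 16) with h1 | h1
      · exact ⟨_, _, by norm_num, by norm_num, hbig, h1, Eb1_lt_V1 hbig h1⟩
      rcases le_or_gt (P : ℝ) ((10 : ℝ) ^ 19) with h2 | h2
      · exact ⟨_, _, by norm_num, by norm_num, h1.le, h2, Eb1_lt_V2 h1.le h2⟩
      · exact ⟨_, _, by norm_num, by norm_num, h2.le, h19, Eb1_lt_V3b h2.le h19⟩
    · -- the lifted large branch `2·10¹⁹ < P ≤ 2.5·10²²`: constant `c(L₁)` per window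
      have hbig19 : (2 * 10 ^ 19 : ℝ) ≤ P := h19.le
      suffices hwin : ∃ X₀ X₁ L₁ c : ℝ, 1 < X₀ ∧ X₁ ≤ 2.169e25 ∧ X₀ ≤ (P : ℝ) ∧ (P : ℝ) ≤ X₁ ∧
          L₁ ≤ Real.log X₀ ∧ 0 < L₁ ∧ c ≤ 2.9 ∧
          c ^ 2 ≤ 4 * 0.99925 * (1.8018 * L₁ / (L₁ + 9.6567) + 0.18488 * L₁ / (L₁ + 15.6481)) ∧
          (nicolasERH P + ((0.0463 + (1 + 2 / Real.log X₀) * (2.961e-12 * √X₁)) - nicolasBeta) * (1 / (√P * Real.log P) + 1 / (√P * Real.log P ^ 2) + 4 / (√P * Real.log P ^ 3))) * (√(P : ℝ) * Real.log P) < c by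
        obtain ⟨X₀, X₁, L₁, c, hX₀, hX₁, h0, h1, hL₁, hL₁0, hcA, hcC, hlt⟩ := hwin
        have hL₁P : L₁ ≤ Real.log P := hL₁.trans (Real.log_le_log (by linarith) h0)
        have hG := G_large2W hW hbig19 hPB hQP hL₁P hL₁0 hcA hcC
        refine mertens_prod_lt_of hW hP hPB (hlow X₀ X₁ hX₀ hX₁ h0 h1) ?_
        have : (nicolasERH P + ((0.0463 + (1 + 2 / Real.log X₀) * (2.961e-12 * √X₁)) - nicolasBeta) * (1 / (√P * Real.log P) + 1 / (√P * Real.log P ^ 2) + 4 / (√P * Real.log P ^ 3))) < c / (√(P : ℝ) * Real.log P) := by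
          rw [lt_div_iff₀ hsL]; exact hlt
        exact this.trans_le hG
      have hl19 : (44.442 : ℝ) ≤ Real.log (2 * (10 : ℝ) ^ 19) := log_2e19_gt.le
      have hl20 : (46.051 : ℝ) ≤ Real.log ((10 : ℝ) ^ 20) := by
        have := (log_ten_pow_bounds 20).1; push_cast at this; linarith
      have hl21 : (48.354 : ℝ) ≤ Real.log ((10 : ℝ) ^ 21) := by
        have := (log_ten_pow_bounds 21).1; push_cast at this; linarith
      have hl22 : (50.656 : ℝ) ≤ Real.log ((10 : ℝ) ^ 22) := by
        have := (log_ten_pow_bounds 22).1; push_cast at this; linarith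
      have hl2e22 : (51.35 : ℝ) ≤ Real.log (2 * (10 : ℝ) ^ 22) := by
        have e0 := log_mul_ten_pow (a := 2) (by norm_num) 22
        have h2l := Real.log_two_gt_d9
        have h10' := RobinAnalytic.log_ten_gt
        rw [e0]; push_cast; linarith
      rcases le_or_gt (P : ℝ) ((10 : ℝ) ^ 20) with h1 | h1
      · exact ⟨_, _, 44.442, 2.5422, by norm_num, by norm_num, hbig19, h1, hl19, by norm_num,
          by norm_num, by norm_num, Eb1_lt_Z1 hbig19 h1⟩
      rcases le_or_gt (P : ℝ) ((10 : ℝ) ^ 21) with h2 | h2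
      · exact ⟨_, _, 46.051, 2.5504, by norm_num, by norm_num, h1.le, h2, hl20, by norm_num,
          by norm_num, by norm_num, Eb1_lt_Z2 h1.le h2⟩
      rcases le_or_gt (P : ℝ) ((10 : ℝ) ^ 22) with h3 | h3
      · exact ⟨_, _, 48.354, 2.5614, by norm_num, by norm_num, h2.le, h3, hl21, by norm_num,
          by norm_num, by norm_num, Eb1_lt_Z3 h2.le h3⟩
      rcases le_or_gt (P : ℝ) (2 * (10 : ℝ) ^ 22) with h4 | h4
      · exact ⟨_, _, 50.656, 2.5716, by norm_num, by norm_num, h3.le, h4, hl22, by norm_num,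
          by norm_num, by norm_num, Eb1_lt_Z4 h3.le h4⟩
      · exact ⟨_, _, 51.35, 2.5745, by norm_num, by norm_num, h4.le, hPX, hl2e22, by norm_num,
          by norm_num, by norm_num, Eb1_lt_Z5 h4.le hPX⟩
  · -- the cells `4¹¹ ≤ P < 2·10¹⁰ < 4¹⁸`, budget `budgetPT1 4¹¹ (2·10¹⁰) ≤ 0.04631`
    rw [not_le] at hbig
    have hP18 : P < 4 ^ 18 := by
      have : (P : ℝ) < 4 ^ 18 := hbig.trans (by norm_num)
      exact_mod_cast this
    have h1 := hlow ((4 : ℝ) ^ 11) (2 * 10 ^ 10) (by norm_num) (by norm_num) hPr hbig.le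
    have h1' := h1.trans (Eb_mono hP1 budgetPT1_cells_le)
    refine mertens_prod_lt_of hW hP hPB h1' ?_
    have hb : nicolasBeta ≤ 0.04631 := by linarith [FordL33.nicolasBeta_lt_d5]
    have hb' : (0.04631 : ℝ) * 1.1875 ≤ ((Cells.bU : ℚ) : ℝ) := by
      simp only [Cells.bU]; push_cast; norm_num
    exact key_ineq_cellsW hW (eboxOn_Eb hb hb') hP hP18 hPB hQP

open scoped ArithmeticFunction.sigma in
/-- **HEADLINE (gen 8, lifted): Robin's inequality at every colossally abundant `N > 5040` all of whose primes are
`≤ 2.5·10²²`** (`robinCA_below (2.5·10²² + 1)`), modulo the SAME print-only list {Büthe 2016 Thm 2, Büthe 2018 Thm 2,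
BKLNW 2021, RH(3 000 175 332 800) Platt–Trudgian} — four THEOREMS IN PRINT in hypothesis position, no conjecture.
`RobinFiniteE3Main.robinCA_below_PT`'s bookkeeping with `mertensProdLt_PT2`.  Informal n-currency: Robin for `5040 < n < 10^(10^22.03)` for the
extremal (CA) candidates.  Nothing here bears on the truth of RH. -/
theorem robinCA_below_PT2 (h16 : Buthe2016_thm2) (hB : Buthe2018_thm2_theta)
    (hK : BroadbentEtAl2021_theta_rel_1e19) (hRH : RiemannHypothesisUpTo 3000175332800) :
    robinCA_below (25 * 10 ^ 21 + 1) := by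
  intro N hCA h5040 hprimes
  obtain ⟨ε, P, Q, -, -, hP, hPN, -, hQP, hpf, -, -, hσ, hθ, -⟩ := hCA.exists_structure
  by_cases hsmall : P < 4 ^ 11
  · refine robinCA_below_four_pow_eleven N hCA h5040 fun p hp hpN => lt_of_le_of_lt ?_ hsmall
    have hN0 : N ≠ 0 := by omega
    have : p ∈ N.primeFactors := Nat.mem_primeFactors.2 ⟨hp, hpN, hN0⟩
    rw [hpf] at this
    exact (Nat.mem_primesLE.1 this).1
  · rw [not_lt] at hsmall
    have hPX : (P : ℝ) ≤ 25 * (10 : ℝ) ^ 21 := by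
      have := hprimes P hP hPN
      exact_mod_cast Nat.lt_succ_iff.1 this
    have hlt := mertensProdLt_PT2 h16 hB hK hRH hsmall hPX hQP
    have hN0 : N ≠ 0 := by omega
    have hNpos : (0 : ℝ) < N := by exact_mod_cast Nat.pos_of_ne_zero hN0
    have hθpos : 0 < θ P + θ Q := by
      have h1 : 0 < θ (P : ℝ) := Chebyshev.theta_pos (by exact_mod_cast hP.two_le)
      have h2 : 0 ≤ θ (Q : ℝ) := Chebyshev.theta_nonneg _
      linarith
    have hlog : Real.log (θ P + θ Q) ≤ Real.log (Real.log N) := Real.log_le_log hθpos hθ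
    have hlt' : (σ 1 N : ℝ) / N < rexp eulerMascheroniConstant * Real.log (Real.log N) :=
      lt_of_le_of_lt hσ (hlt.trans_le (mul_le_mul_of_nonneg_left hlog (Real.exp_pos _).le))
    unfold robinInequality
    rw [div_lt_iff₀ hNpos] at hlt'
    linarith

/-- `robinCA_below` is antitone in the prime bound. -/
theorem robinCA_below_anti {X Y : ℕ} (hXY : X ≤ Y) (h : robinCA_below Y) : robinCA_below X :=
  fun N hN h5040 hp => h N hN h5040 (fun p hp' hpN => lt_of_lt_of_le (hp p hp' hpN) hXY)

/-- **Corollary (the `c = 1` figure without the lifted constant's range): `robinCA_below (10²¹ + 1)`.** -/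
theorem robinCA_below_PT1 (h16 : Buthe2016_thm2) (hB : Buthe2018_thm2_theta)
    (hK : BroadbentEtAl2021_theta_rel_1e19) (hRH : RiemannHypothesisUpTo 3000175332800) :
    robinCA_below (10 ^ 21 + 1) :=
  robinCA_below_anti (by norm_num) (robinCA_below_PT2 h16 hB hK hRH)

#print axioms robinCA_below_PT2

end Summit.RiemannHypothesis.RiemannHypothesis.Theorems.Splittings.RobinFiniteC1
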